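import Summits.MatrixMultiplication.MatrixMultiplication.Theorems.AbelianSTPPCensusShapeCertVQFinalS
import Summits.MatrixMultiplication.MatrixMultiplication.Theorems.AbelianSTPPCensusLeafTE417Closed
import Summits.MatrixMultiplication.MatrixMultiplication.Theorems.AbelianSTPPCensusShapeCertVQEvalS418
import Summits.MatrixMultiplication.MatrixMultiplication.Theorems.AbelianSTPPCensusShapeCertVQEvalS419
import Summits.MatrixMultiplication.MatrixMultiplication.Theorems.AbelianSTPPCensusShapeCertVQEvalS420
import Summits.MatrixMultiplication.MatrixMultiplication.Theorems.AbelianSTPPCensusShapeCertVQEvalS421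
import Summits.MatrixMultiplication.MatrixMultiplication.Theorems.AbelianSTPPCensusShapeCertVQEvalS422
import Summits.MatrixMultiplication.MatrixMultiplication.Theorems.AbelianSTPPCensusShapeCertVQEvalS423
import Summits.MatrixMultiplication.MatrixMultiplication.Theorems.AbelianSTPPCensusShapeCertVQEvalS424
import Summits.MatrixMultiplication.MatrixMultiplication.Theorems.AbelianSTPPCensusShapeCertVQEvalS425
import Summits.MatrixMultiplication.MatrixMultiplication.Theorems.AbelianSTPPCensusShapeCertVQEvalS426
import Summits.MatrixMultiplication.MatrixMultiplication.Theorems.AbelianSTPPCensusShapeCertVQEvalS427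
import Summits.MatrixMultiplication.MatrixMultiplication.Theorems.AbelianSTPPCensusShapeCertVQEvalS428
import Summits.MatrixMultiplication.MatrixMultiplication.Theorems.AbelianSTPPCensusShapeCertVQEvalS429
import Summits.MatrixMultiplication.MatrixMultiplication.Theorems.AbelianSTPPCensusShapeCertVQEvalS430
import Summits.MatrixMultiplication.MatrixMultiplication.Theorems.AbelianSTPPCensusShapeCertVQEvalS431
import Summits.MatrixMultiplication.MatrixMultiplication.Theorems.AbelianSTPPCensusShapeCertVQEvalS432
import Summits.MatrixMultiplication.MatrixMultiplication.Theorems.AbelianSTPPCensusShapeCertVQEvalS433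
import Summits.MatrixMultiplication.MatrixMultiplication.Theorems.AbelianSTPPCensusShapeCertVQEvalS434
import Summits.MatrixMultiplication.MatrixMultiplication.Theorems.AbelianSTPPCensusShapeCertVQEvalS435
import Summits.MatrixMultiplication.MatrixMultiplication.Theorems.AbelianSTPPCensusShapeCertVQEvalS436
import Summits.MatrixMultiplication.MatrixMultiplication.Theorems.AbelianSTPPCensusShapeCertVQEvalS437
import Summits.MatrixMultiplication.MatrixMultiplication.Theorems.AbelianSTPPCensusShapeCertVQEvalS438
import Summits.MatrixMultiplication.MatrixMultiplication.Theorems.AbelianSTPPCensusShapeCertVQEvalS439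

/-!
# Rung leaf F-M1.T_E beyond the vP wall — no abelian STPP host of order ≤ 439 beats exponent 5/2

Cell mm-stpp, rung F-M1; successor kernel item VQ-CERT (HOME/mm-stpp-eng-2/energy3/VQ-CERT-SPEC.md) filed in support of the closed
crux item stmt-MatrixMultiplication-19191; seat mm-stpp-vp-p2 (gen 2).  Extends vp-p2 g1's `noAbelianSTPPHostUpTo_250_417`
(`…LeafTE417Closed`) by the orders `418 ≤ M ≤ 439` with the checker `ShapeCertVQ.checkQS` (`…ShapeCertVQDefsS`: g1's budgeted vQ
search with the saturated-regime E3⁺ continuation budget, the packing skip, the rest-budget first-member test, the child budget prune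
and the blocked candidate walk with a level cap; soundness `…ShapeCertVQBudgetS` / `…TablesS` / `…SearchS`, path segments `…SearchPS`,
bridge `…ShapeCertVQFinalS`), kernel-evaluated order by order from planner-sized path segments (`…ShapeCertVQEvalS<M>a…`, `decide +kernel`,
standard axioms, no `native_decide`) assembled in `…ShapeCertVQEvalS<M>`.  Hence `shapeExclusionVQ_338_439` and the named leaf
**`noAbelianSTPPHostUpTo_250_439 : NoAbelianSTPPHostUpTo (5/2) 439`**.
WHAT THIS IS NOT: no bound on `ω`; a rung leaf (finite range of a necessary condition), never summit credit; no existence claim; nothing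
about orders `≥ 440` (the checker's verdict stays EXCLUDED through 471 in the seat's sizing and FAILS at 472, where the vQ-alive list
`(6,6,8)⁴+(3,4,4)` of `…VQWitness472` lives; the vQ instrument itself is blind there).
-/

set_option linter.dupNamespace false -- `MatrixMultiplication.MatrixMultiplication` (summit = problem, D-0017)
set_option autoImplicit false

namespace Summit.MatrixMultiplication.MatrixMultiplication.Theorems

open Finset STPPThreeRoomEnergy

/-- **The vQ certificate `checkQS` holds at every order `418 ≤ M ≤ 439`.** -/
theorem ShapeCertVQ.checkQS_418_439 (M : ℕ) (h₁ : 418 ≤ M) (h₂ : M ≤ 439) : ShapeCertVQ.checkQS M = true := by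
  interval_cases M
  · exact ShapeCertVQ.checkQS_418
  · exact ShapeCertVQ.checkQS_419
  · exact ShapeCertVQ.checkQS_420
  · exact ShapeCertVQ.checkQS_421
  · exact ShapeCertVQ.checkQS_422
  · exact ShapeCertVQ.checkQS_423
  · exact ShapeCertVQ.checkQS_424
  · exact ShapeCertVQ.checkQS_425
  · exact ShapeCertVQ.checkQS_426
  · exact ShapeCertVQ.checkQS_427
  · exact ShapeCertVQ.checkQS_428
  · exact ShapeCertVQ.checkQS_429
  · exact ShapeCertVQ.checkQS_430
  · exact ShapeCertVQ.checkQS_431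
  · exact ShapeCertVQ.checkQS_432
  · exact ShapeCertVQ.checkQS_433
  · exact ShapeCertVQ.checkQS_434
  · exact ShapeCertVQ.checkQS_435
  · exact ShapeCertVQ.checkQS_436
  · exact ShapeCertVQ.checkQS_437
  · exact ShapeCertVQ.checkQS_438
  · exact ShapeCertVQ.checkQS_439

/-- **vQ shape exclusion for `T_E` (`τ = 5/2`) at the orders `338 ≤ M ≤ 439`**: no shape list with at least two members that
satisfies the vP sieve system and the E3⁺ condition beats `5/2`. [original] -/
theorem shapeExclusionVQ_338_439 : ∀ (N M : ℕ) (a b c : Fin N → ℕ), 2 ≤ N → 338 ≤ M → M ≤ 439 →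
    SieveAdmissibleVP M a b c → E3pAdm M a b c → ¬ Beats (5 / 2) M a b c := by
  intro N M a b c hN h₁ h₂
  rcases Nat.lt_or_ge M 418 with k | g
  · exact shapeExclusionVQ_338_417 N M a b c hN h₁ (by omega)
  · exact ShapeCertVQ.shapeExclusionVQ_of_checkQS (by omega) (ShapeCertVQ.checkQS_418_439 M g h₂) N a b c hN

/-- **Rung leaf T_E/439 (closed, beyond the vP wall).** No finite abelian group of order at most `439` hosts an STPP family
beating exponent `5/2`: `Σ_i (|A_i||B_i||C_i|)^{5/6} ≤ |H|` for every STPP family in every such `H`. [original] -/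
theorem noAbelianSTPPHostUpTo_250_439 : NoAbelianSTPPHostUpTo (5 / 2) 439 := by
  classical
  refine AbelianTECensus.noAbelianSTPPHostUpTo_of_two (τ := 5 / 2) (by norm_num) (by norm_num) ?_
  intro H _ _ hM N A B C hS hne hN
  by_cases h337 : Fintype.card H ≤ 337
  · exact noAbelianSTPPHost_250_337 H h337 N A B C hS
  · have hadm : SieveAdmissibleVP (Fintype.card H) (fun i => (A i).card) (fun i => (B i).card) (fun i => (C i).card) :=
      ⟨AbelianTECensus.sieveSound H N A B C hS hne, u11GSound_holds H N A B C hS hne,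
        fun hp => STPPRepCount.u11PSound H hp N A B C hS hne⟩
    have hE : E3pAdm (Fintype.card H) (fun i => (A i).card) (fun i => (B i).card) (fun i => (C i).card) :=
      e3pAdm_of_isSTPP hS hne
    have h := shapeExclusionVQ_338_439 N (Fintype.card H) _ _ _ hN (by omega) hM hadm hE
    unfold Beats at h
    push Not at h
    simpa [shapeVol] using h

end Summit.MatrixMultiplication.MatrixMultiplication.Theorems
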